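/-
Copyright (c) 2026 the pub-hodgecm-mathlib formalisation cell (harness21).  Prover seat hodgecm-mathlib-LH4-p14 (g5), req620 Track A «(D-RAM) FOUR-FRAME» squad, unit U2H:
the (ρ2b′-X) child `stub_U2H_fixedPointCensus_typeTwo_unit0` (U2H ED. 15 :418) — bottom (A) (type U) of the payer's MAP v3, item 11 «ε ∕ hreal» of LH4-p11 (g5)'s
BOTTOM-A RECIPE v1 (hand taken 2026-09-04T06:50Z).  2026-09-04.
-/
import Summits.HodgeConjecture.HodgeConjecture.Theorems.F0P3cDyRamTokenRealizabilityUnr   -- ★ (LH4-p13 (g5)): `realizable_of_frame`; brings ★ p857485 `WildQuadraticDatumNormOneDepth`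
import HarnessLib

/-!
# Crux `H413`, line LH4 «(D-RAM) FOUR-FRAME» — unit U2H, (ρ2b′-X) bottom (A): THE WELD'S `hreal` FROM THE SOCKET-(A) LETTERS

Cell `hodgecm-mathlib` (D-0151), FLOOR 0, crux item H413 = `stmt-HodgeConjecture-24833`, route of record `HCCMUnconditional`; squad F0∕P3c∕LH4; registered stub served:
`F0P3cDyRamFourFrameU2H.stub_U2H_fixedPointCensus_typeTwo_unit0` ((ρ2b′-X), U2H ED. 15 :418), through the payer's pay line … ∘ ★ `TypeSplit.orderCountCensus2_of_types (hA) …`,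
typed bottom (A) = `SOCKET-hOCA.v1` (LH4-p11 (g5)).  THEOREMS ONLY (no `def`, no instance, no notation, no `sorry`); lane `--supports stmt-HodgeConjecture-24833` (count-neutral).

WHAT IS PROVED.  The last binder `hreal` of ★ `F0P3cDyRamToricLevelCensusUnrAtThirdField.toricCensusSum_unr_weld_of_frame` (the G-side weld of bottom (A)),
`(ε = 1 ∧ m ≡ d (2) ∧ 1 ≤ m ∧ m + d ≤ jl) ∨ (ε = −1 ∧ m = jl − d + 1 ∧ d ≤ jl)`, from: the descent datum `IsRamifiedQuadraticDatum σ ϖ d t` of `E = L_w` and `|2|_E < 1`;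
the frame letters of the socket on `K = M` (`ρ, Θ` commuting isometric involutions), the place `jE : E →+* K` (`ρ z = z ↔ z ∈ jE(E)`, `Θ ∘ jE = jE ∘ σ`, `|jE a| = |a|` —
type U); the socket's TYPE-(A) letters AS PRINTED (`|α| ≤ 1`, `|α − ρα| = 1`, `|ρα − Θα| < 1`); the T5a letters `lam·Θ lam = 1`, `ρ u = u`, `u·Θ u = 1`, `|lam − u| = exp(−m)`,
`|(lam − u) − ρ(lam − u)| = exp(−jl)`; the tube depth `d ≤ m`, the level parity `jl ≡ 0 (2)` and the sign `ε = (−1)^{m+d}` (★ `F0P3cDyRamTokenSignUnr`).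
* §1 `thetaRhoFixed_generator`: from the printed type letters an EXACT generator of the unramified descent field `Fix(Θρ)`: `α′ := α · ρ(Θα)` has `Θα′ = ρα′`, `|α′| ≤ 1`,
  `|α′ − ρα′| = 1` (`α′ − ρα′ = (α − ρα)(α + ρα) + (small)`, and `|α + ρα| = |2α − (α − ρα)| = 1` at a wild place).
* §2 the E-side inputs of ★ `realizable_of_frame` ALONG `jE`: `fixed_fixed_even` (`ρ`- and `Θ`-fixed non-zero elements have even valuation), `norm_sub_one_le_along`,
  `norm_sub_one_eq_along` (★ p857485 transported).
* §3 HEAD `hreal_of_frame_typeU` = ★ `realizable_of_frame` at `α′` with §2's inputs, then the parity bookkeeping `ε = (−1)^{m+d}`: branch 1 has `m + d` even, branch 2 has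
  `m + d = jl + 1` odd.
HONEST LABEL.  Count-neutral helper; (ρ2b′-X) OPEN; `HC_CM` is proved only modulo the 7 printed citations (2 remaining named inputs: hLiu418 = `stmt-HodgeConjecture-24832`, h413 =
`stmt-HodgeConjecture-24833`) until rung 0 closes.

## References
* [Serre1979] J.-P. Serre, *Local Fields*, GTM 67 (1979), Ch. III §6 Prop. 12; Ch. V §2 Prop. 3, §3 Prop. 5.
* [Rogawski1990] J. D. Rogawski, *Automorphic Representations of Unitary Groups in Three Variables*, Ann. of Math. Stud. 123 (1990), §4.9 Lemma 4.9.3 p. 56.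
-/

set_option autoImplicit false

noncomputable section

open WithZero

namespace Summit.HodgeConjecture.HodgeConjecture.Cruxes.H413.F0P3cDyRamTokenRealizabilityUnrOfFrame

/-! ## §1 An exact generator of `Fix(Θρ)` from the printed type-(A) letters -/

section Generator

variable {K : Type*} [Field K] [Valued K ℤᵐ⁰]

/-- **`|α + ρα| = 1` at a wild place**: `α + ρα = 2α − (α − ρα)` with `|2α| < 1 = |α − ρα|`. [cite: Serre1979, Ch. III §6 Prop. 12] -/
theorem v_add_map_eq_one {ρ : K →+* K} (h2 : Valued.v (2 : K) < 1) {α : K} (hα1 : Valued.v α ≤ 1) (hα : Valued.v (α - ρ α) = 1) :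
    Valued.v (α + ρ α) = 1 := by
  have h2α : Valued.v (2 * α) < Valued.v (α - ρ α) := by
    rw [hα, Valuation.map_mul]
    calc Valued.v (2 : K) * Valued.v α ≤ Valued.v (2 : K) * 1 := by gcongr
      _ < 1 := by rw [mul_one]; exact h2
  have h : α + ρ α = 2 * α - (α - ρ α) := by ring
  rw [h, Valuation.map_sub_eq_of_lt_right _ h2α, hα]

/-- **THE EXACT GENERATOR**: for commuting involutions `ρ, Θ` (`ρ` isometric), `|2| < 1`, and `α` with `|α| ≤ 1`, `|α − ρα| = 1`, `|ρα − Θα| < 1` (the socket's type-(A)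
letters), `α′ := α · ρ(Θα)` satisfies `Θα′ = ρα′`, `|α′| ≤ 1`, `|α′ − ρα′| = 1`. [cite: Serre1979, Ch. III §6 Prop. 12] -/
theorem thetaRhoFixed_generator {ρ Θ : K →+* K} (hρρ : ∀ x, ρ (ρ x) = x) (hΘΘ : ∀ x, Θ (Θ x) = x) (hΘρ : ∀ x, Θ (ρ x) = ρ (Θ x))
    (hvρ : ∀ x, Valued.v (ρ x) = Valued.v x) (hvΘ : ∀ x, Valued.v (Θ x) = Valued.v x) (h2 : Valued.v (2 : K) < 1)
    {α : K} (hα1 : Valued.v α ≤ 1) (hα : Valued.v (α - ρ α) = 1) (hτα : Valued.v (ρ α - Θ α) < 1) :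
    Θ (α * ρ (Θ α)) = ρ (α * ρ (Θ α)) ∧ Valued.v (α * ρ (Θ α)) ≤ 1 ∧ Valued.v (α * ρ (Θ α) - ρ (α * ρ (Θ α))) = 1 := by
  have hΘα' : Θ (α * ρ (Θ α)) = ρ (α * ρ (Θ α)) := by
    rw [map_mul, map_mul, hΘρ, hΘΘ, hρρ, mul_comm]
  have hvρΘα : Valued.v (ρ (Θ α)) ≤ 1 := by rw [hvρ, hvΘ]; exact hα1
  refine ⟨hΘα', ?_, ?_⟩
  · rw [Valuation.map_mul]
    calc Valued.v α * Valued.v (ρ (Θ α)) ≤ 1 * 1 := by gcongr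
      _ = 1 := mul_one 1
  · -- `α′ − ρα′ = (α − ρα)(α + ρα) + (α·c − ρα·c′)`, `c := ρ(Θα) − α`, `c′ := Θα − ρα`, both of valuation `< 1`
    have hc : Valued.v (ρ (Θ α) - α) < 1 := by
      have h : ρ (Θ α) - α = ρ (Θ α - ρ α) := by rw [map_sub, hρρ]
      rw [h, hvρ, ← Valuation.map_neg, neg_sub]; exact hτα
    have hc' : Valued.v (Θ α - ρ α) < 1 := by rw [← Valuation.map_neg, neg_sub]; exact hτα
    have hmain : Valued.v ((α - ρ α) * (α + ρ α)) = 1 := by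
      rw [Valuation.map_mul, hα, v_add_map_eq_one h2 hα1 hα, mul_one]
    have hsmall : Valued.v (α * (ρ (Θ α) - α) - ρ α * (Θ α - ρ α)) < Valued.v ((α - ρ α) * (α + ρ α)) := by
      rw [hmain]
      refine (Valuation.map_sub _ _ _).trans_lt (max_lt ?_ ?_)
      · rw [Valuation.map_mul]
        calc Valued.v α * Valued.v (ρ (Θ α) - α) ≤ 1 * Valued.v (ρ (Θ α) - α) := by gcongr
          _ < 1 := by rw [one_mul]; exact hc
      · rw [Valuation.map_mul, hvρ]
        calc Valued.v α * Valued.v (Θ α - ρ α) ≤ 1 * Valued.v (Θ α - ρ α) := by gcongr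
          _ < 1 := by rw [one_mul]; exact hc'
    have h : α * ρ (Θ α) - ρ (α * ρ (Θ α)) = (α - ρ α) * (α + ρ α) + (α * (ρ (Θ α) - α) - ρ α * (Θ α - ρ α)) := by
      rw [map_mul, hρρ]; ring
    rw [h, Valuation.map_add_eq_of_lt_left _ hsmall, hmain]

end Generator

/-! ## §2 The E-side inputs of ★ `realizable_of_frame` along the place `jE : E → M` -/

section Along

variable {E : Type} [Field E] [Valued E ℤᵐ⁰] {σ : E →+* E} {ϖ : E} {d t : ℕ}
variable {K : Type} [Field K] [Valued K ℤᵐ⁰]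

/-- **`ρ`- and `Θ`-fixed non-zero elements of `M` have even valuation** (they are `jE a` with `σ a = a`; the datum's clause for `σ`-fixed elements of `E`, `|jE a| = |a|`).
[cite: Serre1979, Ch. III §6 Prop. 12] -/
theorem fixed_fixed_even (hD : Literature.NumberTheory.Automorphic.UnitaryThreeFourFrame.IsRamifiedQuadraticDatum σ ϖ d t)
    {ρ Θ : K →+* K} (jE : E →+* K) (hjfix : ∀ z : K, ρ z = z ↔ ∃ a, jE a = z) (hΘj : ∀ a, Θ (jE a) = jE (σ a))
    (hjv : ∀ a, Valued.v (jE a) = Valued.v a) :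
    ∀ z : K, ρ z = z → Θ z = z → z ≠ 0 → ∃ n : ℤ, Valued.v z = exp (2 * n) := by
  intro z hρz hΘz hz0
  obtain ⟨a, rfl⟩ := (hjfix z).1 hρz
  have hσa : σ a = a := jE.injective (by rw [← hΘj, hΘz])
  have ha0 : a ≠ 0 := fun h => hz0 (by rw [h, map_zero])
  obtain ⟨n, hn⟩ := hD.2.2.2.1 a hσa ha0
  exact ⟨n, by rw [hjv, hn]⟩

/-- **`|N(1+e) − 1| ≤ |jE ϖ|^{r+d−1}` along `jE`** for `ρ`-fixed `e ∈ M` with `|e| ≤ |jE ϖ|^r`, `d ≤ r + 1` (`e = jE a`, `e + Θe + e·Θe = jE (a + σa + a·σa)`; ★ p857485).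
[cite: Serre1979, Ch. V §3 Prop. 5] -/
theorem norm_sub_one_le_along (hD : Literature.NumberTheory.Automorphic.UnitaryThreeFourFrame.IsRamifiedQuadraticDatum σ ϖ d t)
    {ρ Θ : K →+* K} (jE : E →+* K) (hjfix : ∀ z : K, ρ z = z ↔ ∃ a, jE a = z) (hΘj : ∀ a, Θ (jE a) = jE (σ a))
    (hjv : ∀ a, Valued.v (jE a) = Valued.v a) :
    ∀ e : K, ρ e = e → ∀ r : ℕ, d ≤ r + 1 → Valued.v e ≤ Valued.v (jE ϖ) ^ r → Valued.v (e + Θ e + e * Θ e) ≤ Valued.v (jE ϖ) ^ (r + d - 1) := by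
  intro e hρe r hr he
  obtain ⟨a, rfl⟩ := (hjfix e).1 hρe
  have h : jE a + Θ (jE a) + jE a * Θ (jE a) = jE (a + σ a + a * σ a) := by rw [hΘj, map_add, map_add, map_mul]
  rw [h]
  simp only [hjv] at he ⊢
  exact Literature.NumberTheory.LocalFields.WildQuadraticDatum.v_norm_sub_one_le_of_isRamifiedQuadraticDatum hD hr he

/-- **`|N(1+e) − 1| = |jE ϖ|^{r+d−1}` EXACTLY along `jE`** for `ρ`-fixed `e ∈ M` with `|e| = |jE ϖ|^r`, `d ≤ r`, `r ≢ d (2)` (★ p857485). [cite: Serre1979, Ch. V §3 Prop. 5] -/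
theorem norm_sub_one_eq_along (hD : Literature.NumberTheory.Automorphic.UnitaryThreeFourFrame.IsRamifiedQuadraticDatum σ ϖ d t)
    {ρ Θ : K →+* K} (jE : E →+* K) (hjfix : ∀ z : K, ρ z = z ↔ ∃ a, jE a = z) (hΘj : ∀ a, Θ (jE a) = jE (σ a))
    (hjv : ∀ a, Valued.v (jE a) = Valued.v a) :
    ∀ e : K, ρ e = e → ∀ r : ℕ, d ≤ r → Valued.v e = Valued.v (jE ϖ) ^ r → r % 2 ≠ d % 2 →
      Valued.v (e + Θ e + e * Θ e) = Valued.v (jE ϖ) ^ (r + d - 1) := by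
  intro e hρe r hr he hpar
  obtain ⟨a, rfl⟩ := (hjfix e).1 hρe
  have h : jE a + Θ (jE a) + jE a * Θ (jE a) = jE (a + σ a + a * σ a) := by rw [hΘj, map_add, map_add, map_mul]
  rw [h]
  simp only [hjv] at he ⊢
  exact Literature.NumberTheory.LocalFields.WildQuadraticDatum.v_norm_sub_one_eq_of_isRamifiedQuadraticDatum hD hr he hpar

end Along

/-! ## §3 HEAD: the weld's `hreal` from the socket-(A) letters -/

/-- **THE WELD'S `hreal` ON TYPE U** (last binder of ★ `toricCensusSum_unr_weld_of_frame`, VERBATIM): for the descent datum `(σ, ϖ, d, t)` of `E = L_w` with `|2|_E < 1`,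
the frame `(ρ, Θ)` of `M` with the place `jE` (unramified: `|jE a| = |a|`), the printed type-(A) letters of `α`, `2 ≤ d`, the T5a letters of `(lam, u)` with depths `m`
(`|lam − u| = exp(−m)`, `d ≤ m`) and `jl` (`|(lam − u) − ρ(lam − u)| = exp(−jl)`, even), and the sign `ε = (−1)^{m+d}`:
`(ε = 1 ∧ m ≡ d (2) ∧ 1 ≤ m ∧ m + d ≤ jl) ∨ (ε = −1 ∧ m = jl − d + 1 ∧ d ≤ jl)`.  Proof: ★ `realizable_of_frame` at the exact generator `α′ = α·ρ(Θα)` of §1 with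
the E-side inputs of §2, then parity bookkeeping. [cite: Serre1979, Ch. V §3 Prop. 5; Ch. V §2 Prop. 3] [cite: Rogawski1990, §4.9 Lemma 4.9.3 p. 56] -/
theorem hreal_of_frame_typeU {E : Type} [Field E] [Valued E ℤᵐ⁰] {σ : E →+* E} {ϖ : E} {d t : ℕ}
    (hD : Literature.NumberTheory.Automorphic.UnitaryThreeFourFrame.IsRamifiedQuadraticDatum σ ϖ d t) (h2v : Valued.v (2 : E) < 1)
    {K : Type} [Field K] [Valued K ℤᵐ⁰] {ρ Θ : K →+* K}
    (hρρ : ∀ x, ρ (ρ x) = x) (hvρ : ∀ x, Valued.v (ρ x) = Valued.v x) (hΘΘ : ∀ x, Θ (Θ x) = x) (hΘρ : ∀ x, Θ (ρ x) = ρ (Θ x))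
    (hvΘ : ∀ x, Valued.v (Θ x) = Valued.v x)
    (jE : E →+* K) (hjfix : ∀ z : K, ρ z = z ↔ ∃ a, jE a = z) (hΘj : ∀ a, Θ (jE a) = jE (σ a)) (hjv : ∀ a, Valued.v (jE a) = Valued.v a)
    {α : K} (hα1 : Valued.v α ≤ 1) (hα : Valued.v (α - ρ α) = 1) (hτα : Valued.v (ρ α - Θ α) < 1) (hd2 : 2 ≤ d)
    {lam u : K} (hlam : lam * Θ lam = 1) (hu : ρ u = u) (hu1 : u * Θ u = 1)
    {m jl : ℕ} (hm : Valued.v (lam - u) = exp (-(m : ℤ))) (hjl : Valued.v ((lam - u) - ρ (lam - u)) = exp (-(jl : ℤ)))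
    (hdm : d ≤ m) (hjl2 : jl % 2 = 0) (ε : ℚ) (hε : ε = (-1) ^ (m + d)) :
    (ε = 1 ∧ m % 2 = d % 2 ∧ 1 ≤ m ∧ m + d ≤ jl) ∨ (ε = -1 ∧ m = jl - d + 1 ∧ d ≤ jl) := by
  -- the uniformiser and `|2| < 1` of `M` along `jE`
  have hϖE : Valued.v (jE ϖ) = exp (-1 : ℤ) := by rw [hjv]; exact hD.2.2.1
  have h2K : Valued.v (2 : K) < 1 := by rw [← map_ofNat jE 2, hjv]; exact h2v
  -- the exact generator of `Fix(Θρ)`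
  obtain ⟨hΘα', hα'1, hα'ρ⟩ := thetaRhoFixed_generator hρρ hΘΘ hΘρ hvρ hvΘ h2K hα1 hα hτα
  have hreal := F0P3cDyRamTokenRealizabilityUnr.realizable_of_frame hρρ hΘΘ (fun x => (hΘρ x).symm) hvρ hvΘ hϖE h2K hΘα' hα'1 hα'ρ
    (fixed_fixed_even hD jE hjfix hΘj hjv) hd2 (norm_sub_one_le_along hD jE hjfix hΘj hjv) (norm_sub_one_eq_along hD jE hjfix hΘj hjv)
    hlam hu hu1 hdm hm hjl
  rcases hreal with ⟨hpar, h1, hle⟩ | ⟨hmeq, hdle⟩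
  · refine Or.inl ⟨?_, hpar, h1, hle⟩
    have heven : Even (m + d) := by rw [Nat.even_add, Nat.even_iff, Nat.even_iff, hpar]
    rw [hε, heven.neg_one_pow]
  · refine Or.inr ⟨?_, hmeq, hdle⟩
    have hodd : Odd (m + d) := by
      rw [Nat.odd_iff]; omega
    rw [hε, hodd.neg_one_pow]

end Summit.HodgeConjecture.HodgeConjecture.Cruxes.H413.F0P3cDyRamTokenRealizabilityUnrOfFrame

end
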